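import Summits.QuantumFields.YangMills.Theorems.BalabanUVNodesN15KingModelBlockFieldMassGap
import Summits.QuantumFields.YangMills.Theorems.BalabanUVNodesN15KingModelGaussianLawIdentification
import Summits.QuantumFields.YangMills.Theorems.BalabanUVNodesN15KingModelEffectiveLaplacianContinuumLimit
import Mathlib.Probability.Moments.Covariance
import Mathlib.Probability.Distributions.Gaussian.Basic
import HarnessLib

/-!
# BalabanUVNodes ∕ N15 — THE KING-MODEL RUNG (PART Ϲ-f): THE MEASURE-LEVEL READING — UNDER KING's RG BLOCK-FIELD LAW `dμ^{(K)} = ρ_{Δ^{(K)}}(ψ)dψ`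
# THE TIMESLICE BLOCK FIELDS `Ψ_s = Σ_{b : b_κ = s} ψ(b)` HAVE COVARIANCE `|slice|·Σ_{b_κ = s}(Δ^{(K)})⁻¹(b,0)` — A PURE cosh IN BLOCK TIME WITH MASS `N·ω₀`
# (Track A, DAG node N15 = NE2; FAN-OUT v1.1 §N15 s3 «KING-MODEL RUNG … NE2's analogue DECIDED in the model»; count-neutral)

HONEST FRAMING.  Count-neutral (cell `pub-ymgap`, seat `pub-ymgap-dag-n15-e` g38; `--supports stmt-QuantumFields-27366 --as helper` = K3⁸).
TEMPLATE LITERATURE: C. King, Commun. Math. Phys. **102** (1986) 649–677 [King1986] — the RG block-field MEASURE `dμ^{(k)}` of (2.6) p.652 with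
the free effective action `½⟨ψ, Δ^{(k)}ψ⟩` ((2.14)–(2.17) p.653) is, in the tree, the Gaussian law `FreeField.gaussLaw (effLaplacian N M a N² m²)`
(this seat's PART Ϝ-u: `ρ_A dx`, a probability measure, Gaussian in Mathlib's sense, covariance `A⁻¹`, `= gaussianFieldOfKernel (A⁻¹)`).  The
transfer-matrix reading of Montvay–Münster [MontvayMunster1994] §2.1.2 defines the TIMESLICE FIELD `S(t,0) = L^{−3∕2}Σ_x φ(x,t)` (2.19) and reads
the mass off `⟨S(t₁,0)S(t₂,0)⟩ = Σ_α|c_α|²e^{−|t₁−t₂|E(0,α)}` ((2.20), (2.49)).  PARTS Ϲ-d∕Ϲ-d′ computed the KERNEL statement: the zero-momentum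
timeslice sum of `(Δ^{(K)})⁻¹` is a pure `cosh` in block time with mass `N·ω₀ = 2N·arsinh(√m²∕(2N))`.  THIS FILE lifts it to the MEASURE: the
covariance (= second moment, the law is centred) of the timeslice block fields `Ψ_s`, `Ψ_0` under `dμ^{(K)}` is `|slice|` times that sum, hence a
pure `cosh` in block time for `s ≠ 0`, strictly positive.  NOT Bałaban's covariant objects; NOT a node discharge (N15 is booked through n15-a's
knit, untouched); no transfer operator is constructed; nothing continuum-YM ∕ ℝ⁴ ∕ OS axioms ∕ Clay.  0 `sorry`, 0 `def`.

WHAT THIS FILE PROVES (kernel).  §1 `effLaplacian_coercivePos` (the coercivity constant `(a⁻¹+m⁻²)⁻¹ > 0`; symmetry is the tree's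
`effLaplacian_transpose_eq`), `isProbabilityMeasure_blockFieldLaw`, `memLp_eval_blockFieldLaw` (evaluations
are `L²` under `gaussLaw (effLaplacian N M a N² m²)`), `cov_eval_blockFieldLaw` (`Cov(ψ(b),ψ(b′)) = (Δ^{(K)})⁻¹(b,b′)`), ★ `sum_slice_blockCov_transl`
(`Σ_{b_κ=s}(Δ^{(K)})⁻¹(b,b′) = Σ_{b_κ = s − b′_κ}(Δ^{(K)})⁻¹(b,0)`, Ϙ-a translation invariance).  §2 ★★★ **`cov_timesliceField_blockFieldLaw`**
(`Cov_{dμ^{(K)}}(Ψ_s,Ψ_0) = #{b : b_κ = 0}·Σ_{b_κ = s}(Δ^{(K)})⁻¹(b,0)`), ★★★ **`cov_timesliceField_eq_cosh`** (for `s ≠ 0`: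
`= #{b_κ = 0}·N^{−3}(sinh(Nω₀∕2)∕sinh(ω₀∕2))²∕(2 sinh ω₀(1−e^{−ω₀NM_κ}))·(e^{−Nω₀·val s} + e^{−Nω₀(M_κ−val s)})` — THE TWO-POINT FUNCTION OF THE TIMESLICE
BLOCK FIELDS UNDER KING's RG LAW IS A PURE cosh IN BLOCK TIME WITH MASS `N·ω₀`; the law is centred — `FreeField.integral_eval_gaussLaw` — so this IS the
second moment `∫Ψ_sΨ_0 dμ^{(K)}`), ★★ `cov_timesliceField_pos`, and `cov_timesliceField_gaussianFieldOfKernel` (the same for the tree's Kolmogorov-built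
`gaussianFieldOfKernel ((Δ^{(K)})⁻¹)`).

HONEST SCOPE.  King's `A = 0` free model on the unit torus `Tor M` (`N ≥ 1` fine sites per block side, `a > 0`, `m² > 0`); zero spatial momentum
(full timeslice sums); the mass is read off the kernel's cosh form, no transfer operator ∕ OS reconstruction on the torus is built.  N15 untouched;
counts unmoved.
Locators: [King1986] (2.6) p.652, (2.13)–(2.17) p.653, (4.5) p.670; [MontvayMunster1994] §2.1.2 (2.18)–(2.20), (2.49), §2.2.1 (2.74)–(2.82).
-/

noncomputable section

open scoped BigOperators
open Finset Matrix Real MeasureTheory ProbabilityTheory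

namespace Summit.QuantumFields.YangMills.BalabanUVNodes.N15KingModelRung.TorusSpectral

open Literature.MathematicalPhysics.QuantumFieldTheory (gaussianFieldOfKernel)
open Literature.MathematicalPhysics.QuantumFieldTheory.Balaban1983to89.B5Prop11Plancherel (Tor fine)
open Literature.MathematicalPhysics.QuantumFieldTheory.Balaban1983to89.QGQInverse (Coercive)
open Literature.MathematicalPhysics.QuantumFieldTheory.King1986.Torus
open Summit.QuantumFields.YangMills.BalabanUVNodes.N15KingModelRung.FreeField (gaussLaw gaussLaw_eq_gaussianFieldOfKernel isGaussian_gaussLaw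
  isProbabilityMeasure_gaussLaw covariance_eval_gaussLaw)

variable {d : ℕ} (N : ℕ) [NeZero N] (M : Fin d → ℕ) [hM : ∀ μ, NeZero (M μ)] (κ : Fin d)

/-! ## §1 Letters: the law `dμ^{(K)}`, square integrability of evaluations, the two-point kernel, translation of slices -/

section Letters

variable {a m2 : ℝ}

omit hM in
/-- The coercivity constant `(a⁻¹ + m⁻²)⁻¹` of `Δ^{(K)}` is positive. [cite: King1986, (2.16) p.653] -/
theorem effLaplacian_coercivePos (ha : 0 < a) (hm : 0 < m2) : 0 < (a⁻¹ + m2⁻¹)⁻¹ := by positivity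

/-- King's RG block-field law `dμ^{(K)} = ρ_{Δ^{(K)}}dψ` is a probability measure (every `N ≥ 1`, `a > 0`, `m² > 0`). [cite: King1986, (2.6) p.652] -/
theorem isProbabilityMeasure_blockFieldLaw (hN1 : 1 ≤ N) (ha : 0 < a) (hm : 0 < m2) :
    IsProbabilityMeasure (gaussLaw (effLaplacian N M a ((N : ℝ) ^ 2) m2)) :=
  isProbabilityMeasure_gaussLaw (effLaplacian_coercivePos ha hm) (effLaplacian_coercive N M hN1 ha hm)

/-- Evaluations `ψ ↦ ψ(b)` are square integrable under `dμ^{(K)}` (a Gaussian measure on `ℝ^Ω`; Fernique in finite dimension).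
[cite: King1986, (2.6) p.652] -/
theorem memLp_eval_blockFieldLaw (hN1 : 1 ≤ N) (ha : 0 < a) (hm : 0 < m2) (b : Tor M) :
    MemLp (fun ψ : Tor M → ℝ => ψ b) 2 (gaussLaw (effLaplacian N M a ((N : ℝ) ^ 2) m2)) := by
  haveI := isGaussian_gaussLaw (effLaplacian_coercivePos ha hm) (effLaplacian_coercive N M hN1 ha hm) (effLaplacian_transpose_eq N M _ _ _)
  have h := IsGaussian.memLp_dual (gaussLaw (effLaplacian N M a ((N : ℝ) ^ 2) m2))
    (ContinuousLinearMap.proj (R := ℝ) (φ := fun _ : Tor M => ℝ) b) 2 (by simp)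
  exact h

/-- The two-point kernel of `dμ^{(K)}`: `Cov(ψ(b), ψ(b′)) = (Δ^{(K)})⁻¹(b,b′)` — NE2's unit-layer kernel of the model (g0 `blockCov`).
[cite: King1986, (2.6) p.652, (2.14) p.653] -/
theorem cov_eval_blockFieldLaw (hN1 : 1 ≤ N) (ha : 0 < a) (hm : 0 < m2) (b b' : Tor M) :
    cov[fun ψ : Tor M → ℝ => ψ b, fun ψ : Tor M → ℝ => ψ b'; gaussLaw (effLaplacian N M a ((N : ℝ) ^ 2) m2)]
      = (effLaplacian N M a ((N : ℝ) ^ 2) m2)⁻¹ b b' :=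
  covariance_eval_gaussLaw (effLaplacian_coercivePos ha hm) (effLaplacian_coercive N M hN1 ha hm) (effLaplacian_transpose_eq N M _ _ _) b b'

/-- ★ TRANSLATION OF SLICES: `Σ_{b : b_κ = s} (Δ^{(K)})⁻¹(b, b′) = Σ_{w : w_κ = s − b′_κ} (Δ^{(K)})⁻¹(w, 0)` (PART Ϙ-a's translation invariance of
`(Δ^{(K)})⁻¹`). [cite: King1986, (2.14) p.653, (4.5) p.670] -/
theorem sum_slice_blockCov_transl (a c m2 : ℝ) (b' : Tor M) (s : ZMod (M κ)) :
    ∑ b : Tor M, (if b κ = s then (effLaplacian N M a c m2)⁻¹ b b' else 0)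
      = ∑ w : Tor M, (if w κ = s - b' κ then (effLaplacian N M a c m2)⁻¹ w 0 else 0) := by
  set G : Tor M → ℝ := fun w => (effLaplacian N M a c m2)⁻¹ w 0 with hG
  have h : ∀ b : Tor M, (effLaplacian N M a c m2)⁻¹ b b' = G (b + -b') := by
    intro b
    show (effLaplacian N M a c m2)⁻¹ b b' = (effLaplacian N M a c m2)⁻¹ (b + -b') 0
    rw [← Transl.effLaplacian_inv_transl N M a c m2 (b + -b') 0 b', neg_add_cancel_right, zero_add]
  have h2 : ∑ b : Tor M, (if b κ = s then (effLaplacian N M a c m2)⁻¹ b b' else 0) = ∑ b : Tor M, (if b κ = s then G (b + -b') else 0) :=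
    Finset.sum_congr rfl fun b _ => by rw [h]
  rw [h2, sum_slice_comp_add M κ G (-b') s, Pi.neg_apply, ← sub_eq_add_neg]

end Letters

/-! ## §2 The covariance of the timeslice block fields -/

section Covariance

variable {a m2 : ℝ}

/-- ★★★ **THE COVARIANCE OF THE TIMESLICE BLOCK FIELDS UNDER KING's RG LAW**: with `Ψ_s(ψ) = Σ_{b : b_κ = s} ψ(b)`,
`Cov_{dμ^{(K)}}(Ψ_s, Ψ_0) = #{b : b_κ = 0} · Σ_{b : b_κ = s} (Δ^{(K)})⁻¹(b, 0)` — Montvay–Münster's timeslice correlation (2.19)–(2.20) at zero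
momentum for King's block field, reduced to PART Ϲ-d's kernel sum by bilinearity and translation invariance.
[cite: King1986, (2.6) p.652, (2.14) p.653; MontvayMunster1994, §2.1.2 (2.18)–(2.20)] -/
theorem cov_timesliceField_blockFieldLaw (hN1 : 1 ≤ N) (ha : 0 < a) (hm : 0 < m2) (s : ZMod (M κ)) :
    cov[fun ψ : Tor M → ℝ => ∑ b ∈ Finset.univ.filter (fun b : Tor M => b κ = s), ψ b,
        fun ψ : Tor M → ℝ => ∑ b ∈ Finset.univ.filter (fun b : Tor M => b κ = 0), ψ b;
        gaussLaw (effLaplacian N M a ((N : ℝ) ^ 2) m2)]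
      = ((Finset.univ.filter (fun b : Tor M => b κ = 0)).card : ℝ)
          * ∑ b : Tor M, (if b κ = s then (effLaplacian N M a ((N : ℝ) ^ 2) m2)⁻¹ b 0 else 0) := by
  haveI := isProbabilityMeasure_blockFieldLaw N M hN1 ha hm
  rw [covariance_fun_sum_fun_sum' (fun b _ => memLp_eval_blockFieldLaw N M hN1 ha hm b) (fun b _ => memLp_eval_blockFieldLaw N M hN1 ha hm b)]
  simp_rw [cov_eval_blockFieldLaw N M hN1 ha hm]
  rw [Finset.sum_comm]
  -- each `b′` in the slice `0` contributes the same translated slice sum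
  have hterm : ∀ b' ∈ Finset.univ.filter (fun b : Tor M => b κ = 0),
      ∑ b ∈ Finset.univ.filter (fun b : Tor M => b κ = s), (effLaplacian N M a ((N : ℝ) ^ 2) m2)⁻¹ b b'
        = ∑ b : Tor M, (if b κ = s then (effLaplacian N M a ((N : ℝ) ^ 2) m2)⁻¹ b 0 else 0) := by
    intro b' hb'
    have hb0 : b' κ = 0 := (Finset.mem_filter.mp hb').2
    rw [Finset.sum_filter, sum_slice_blockCov_transl N M κ, hb0, sub_zero]
  rw [Finset.sum_congr rfl hterm, Finset.sum_const, nsmul_eq_mul]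

/-- ★★★ **THE TWO-POINT FUNCTION OF THE TIMESLICE BLOCK FIELDS UNDER KING's RG LAW IS A PURE cosh IN BLOCK TIME WITH MASS `N·ω₀`**: for `s ≠ 0`,
`Cov_{dμ^{(K)}}(Ψ_s, Ψ_0) = #{b_κ = 0}·N^{−3}(sinh(Nω₀∕2)∕sinh(ω₀∕2))²∕(2 sinh ω₀(1 − e^{−ω₀NM_κ}))·(e^{−Nω₀·val s} + e^{−Nω₀(M_κ − val s)})`,
`ω₀ = latticeMass(m²∕N²) = 2·arsinh(√m²∕(2N))` — the transfer-matrix form (MM (2.49)) of King's block-field theory on the torus with ONE energy, the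
block mass `N·ω₀` (→ `√m²` at rate `N^{−2}`, PART Ϲ-c). [cite: King1986, (2.6) p.652, (2.14) p.653, (4.5) p.670; MontvayMunster1994, §2.1.2 (2.20), (2.49), §2.2.1 (2.78), (2.82)] -/
theorem cov_timesliceField_eq_cosh (hN1 : 1 ≤ N) (ha : 0 < a) (hm : 0 < m2) {s : ZMod (M κ)} (hs : s ≠ 0) :
    cov[fun ψ : Tor M → ℝ => ∑ b ∈ Finset.univ.filter (fun b : Tor M => b κ = s), ψ b,
        fun ψ : Tor M → ℝ => ∑ b ∈ Finset.univ.filter (fun b : Tor M => b κ = 0), ψ b;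
        gaussLaw (effLaplacian N M a ((N : ℝ) ^ 2) m2)]
      = ((Finset.univ.filter (fun b : Tor M => b κ = 0)).card : ℝ)
          * (((N : ℝ) ^ 3)⁻¹
            * ((Real.sinh (N * latticeMass (m2 / (N : ℝ) ^ 2) / 2) / Real.sinh (latticeMass (m2 / (N : ℝ) ^ 2) / 2)) ^ 2
              / (2 * Real.sinh (latticeMass (m2 / (N : ℝ) ^ 2)) * (1 - Real.exp (-(latticeMass (m2 / (N : ℝ) ^ 2) * N * M κ)))))
            * (Real.exp (-(latticeMass (m2 / (N : ℝ) ^ 2) * N * s.val))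
                + Real.exp (-(latticeMass (m2 / (N : ℝ) ^ 2) * N * (M κ - s.val))))) := by
  rw [cov_timesliceField_blockFieldLaw N M κ hN1 ha hm, timeSlice_blockCov_eq_cosh' N M κ hN1 ha hm hs]

/-- ★★ The timeslice two-point function under King's RG law is STRICTLY POSITIVE at every block separation `s ≠ 0`. [folklore] -/
theorem cov_timesliceField_pos (hN1 : 1 ≤ N) (ha : 0 < a) (hm : 0 < m2) {s : ZMod (M κ)} (hs : s ≠ 0) :
    0 < cov[fun ψ : Tor M → ℝ => ∑ b ∈ Finset.univ.filter (fun b : Tor M => b κ = s), ψ b,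
        fun ψ : Tor M → ℝ => ∑ b ∈ Finset.univ.filter (fun b : Tor M => b κ = 0), ψ b;
        gaussLaw (effLaplacian N M a ((N : ℝ) ^ 2) m2)] := by
  rw [cov_timesliceField_blockFieldLaw N M κ hN1 ha hm]
  refine mul_pos ?_ (timeSlice_blockCov_pos N M κ hN1 ha hm hs)
  have : (0 : Tor M) ∈ Finset.univ.filter (fun b : Tor M => b κ = 0) := by simp
  exact_mod_cast Finset.card_pos.mpr ⟨0, this⟩

/-- The same covariance for the tree's Kolmogorov-built `gaussianFieldOfKernel ((Δ^{(K)})⁻¹)` (PART Ϝ-u's identification `ρ_A dx = gaussianFieldOfKernel A⁻¹`).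
[cite: King1986, (2.6) p.652, (2.14) p.653] -/
theorem cov_timesliceField_gaussianFieldOfKernel (hN1 : 1 ≤ N) (ha : 0 < a) (hm : 0 < m2) (s : ZMod (M κ)) :
    cov[fun ψ : Tor M → ℝ => ∑ b ∈ Finset.univ.filter (fun b : Tor M => b κ = s), ψ b,
        fun ψ : Tor M → ℝ => ∑ b ∈ Finset.univ.filter (fun b : Tor M => b κ = 0), ψ b;
        gaussianFieldOfKernel fun b b' : Tor M => (effLaplacian N M a ((N : ℝ) ^ 2) m2)⁻¹ b b']
      = ((Finset.univ.filter (fun b : Tor M => b κ = 0)).card : ℝ)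
          * ∑ b : Tor M, (if b κ = s then (effLaplacian N M a ((N : ℝ) ^ 2) m2)⁻¹ b 0 else 0) := by
  rw [← gaussLaw_eq_gaussianFieldOfKernel (effLaplacian_coercivePos ha hm) (effLaplacian_coercive N M hN1 ha hm) (effLaplacian_transpose_eq N M _ _ _)]
  exact cov_timesliceField_blockFieldLaw N M κ hN1 ha hm s

end Covariance

end Summit.QuantumFields.YangMills.BalabanUVNodes.N15KingModelRung.TorusSpectral
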